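import Literature.NumberTheory.LFunctions.SchoenfeldZeroSums
import Literature.NumberTheory.LFunctions.ZetaZeroCountExplicit
import HarnessLib

/-!
# The far-zero tail `∑_{|γ − t| ≥ t₀} m(ρ)/(γ − t)²` in Kadiri's method, with crude explicit constants (Acta Arith. 117 (2005), Lemma 4.3; Mossinghoff–Trudgian 2015, `c₃₀`)

Topic `Literature/NumberTheory/LFunctions`. Everything in this file is PROVED (no named fact, no
definition beyond two explicit elementary bound functions). In Kadiri's Prop. 4.4 (the zeros with
`y_k = |kγ₀ − γ| ≥ t₀`) and in Mossinghoff–Trudgian's `C₃(η)` (`p₁, p₂`, the quantities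
`c₃₀(kT₀, t₀)`), one needs an explicit bound for the tail

  `∑_{ρ : |γ − t| ≥ t₀} m(ρ)/(γ − t)²`.

Kadiri (Lemma 4.3) and Mossinghoff–Trudgian ((4.x), via Lehman's lemma and Rosser's `N(T)`
bounds) obtain `≈ 4·10⁻⁵` for `t₀ = 10⁵`. For the tree's discharge of the Mossinghoff–Trudgian–Yang
constant the parameter `t₀` is free (it enters the final constant only through `log(nT₀ + t₀)`),
so CRUDE constants suffice provided the shape `O((log(|t| + t₀) + log t₀)/t₀)` is retained; we
derive such a bound from the tree's PROVED explicit zero counting (`SchoenfeldZeroSums.lean`: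
`N(t) ≤ N⁺(t)`, `N⁻(t) ≤ N(t)` for `t ≥ 7`, from Titchmarsh Thm. 9.4 made explicit,
`abs_zetaArgS_le`): every unit window `(u, u+1]`, `u ≥ 0`, carries at most
`77 + 15 log(u + 6)` zeros (with multiplicity; a closed window `[u, u+1]` at any real `u` at most
`154 + 30 log(|u| + 7)`), and the windows are summed with the elementary telescoping bounds
`∑_{j≥0} 1/(t₀+j)² ≤ 1/t₀² + 1/t₀`, `∑_{j≥0} log(t₀+j)/(t₀+j)² ≤ log t₀/t₀² + (log t₀ + 1)/t₀`
(`t₀ ≥ 4`). Result (`KadiriTail.sum_far_le`, `KadiriTail.summable_far_and_tsum_le`): for `t ≥ 0`,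
`t₀ ≥ 4`,

  `∑'_{ρ : |Im ρ − t| ≥ t₀} m(ρ)/(Im ρ − t)² ≤ 3 B(t, t₀)`,
  `B(C, t₀) = (154 + 30 log(C+7))(1/t₀² + 1/t₀) + 30 (log t₀/t₀² + (log t₀ + 1)/t₀)` (`tailBound`),

the three pieces being `Im ρ ≥ t + t₀`, `0 < Im ρ ≤ t − t₀`, and `Im ρ < 0` (reflected by
conjugation, `m(ρ̄) = m(ρ)`). E.g. `3B(1.3·10¹³, 10⁸) < 5·10⁻⁵`.

## References

* H. Kadiri, Acta Arith. 117 (2005) = arXiv:math/0401238, Lemma 4.3, Prop. 4.4. (`Kadiri2005`)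
* M. J. Mossinghoff, T. S. Trudgian, J. Number Theory 157 (2015) = arXiv:1410.3926, §4 (`c₃₀`).
  (`MossinghoffTrudgian2015`)
* E. C. Titchmarsh, *The theory of the Riemann zeta-function*, 2nd ed. (1986), Thm. 9.4.
  (`Titchmarsh1986`)
-/

noncomputable section

open Real Finset
open scoped ComplexConjugate

namespace Literature.NumberTheory.LFunctions

namespace KadiriTail

open SchoenfeldBound NicolasJExplicit

/-! ## Telescoping series bounds -/

/-- `∑_{j<J} 1/(t₀+j)² ≤ 1/t₀² + 1/t₀ − 1/(t₀+J−1)` for `J ≥ 1`, `t₀ ≥ 1` (telescoping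
`1/(t₀+j)² ≤ 1/(t₀+j−1) − 1/(t₀+j)`). [folklore] -/
theorem sum_inv_sq_le_aux {t₀ : ℝ} (ht₀ : 1 ≤ t₀) (J : ℕ) (hJ : 1 ≤ J) :
    ∑ j ∈ range J, 1 / (t₀ + j) ^ 2 ≤ 1 / t₀ ^ 2 + 1 / t₀ - 1 / (t₀ + J - 1) := by
  induction J, hJ using Nat.le_induction with
  | base => simp
  | succ n hn ih =>
    rw [sum_range_succ]
    have hn' : (1 : ℝ) ≤ n := by exact_mod_cast hn
    have h1 : 0 < t₀ + n - 1 := by linarith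
    have h2 : 0 < t₀ + n := by linarith
    have key : 1 / (t₀ + n) ^ 2 ≤ 1 / (t₀ + n - 1) - 1 / (t₀ + n) := by
      rw [div_sub_div _ _ h1.ne' h2.ne', div_le_div_iff₀ (by positivity) (by positivity)]
      nlinarith
    push_cast
    ring_nf at ih key ⊢
    linarith

/-- **`∑_{j<J} 1/(t₀+j)² ≤ 1/t₀² + 1/t₀`** (`t₀ ≥ 1`). [folklore] -/
theorem sum_inv_sq_le {t₀ : ℝ} (ht₀ : 1 ≤ t₀) (J : ℕ) :
    ∑ j ∈ range J, 1 / (t₀ + j) ^ 2 ≤ 1 / t₀ ^ 2 + 1 / t₀ := by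
  rcases Nat.eq_zero_or_pos J with h | h
  · subst h; simp; positivity
  · have := sum_inv_sq_le_aux ht₀ J h
    have hJ : (1 : ℝ) ≤ J := by exact_mod_cast h
    have : 0 ≤ 1 / (t₀ + J - 1) := by apply div_nonneg zero_le_one; linarith
    linarith

/-- `log 4 > 1.38`. [folklore] -/
theorem log_four_gt : (1.38 : ℝ) < Real.log 4 := by
  have h : Real.log 4 = 2 * Real.log 2 := by
    rw [show (4 : ℝ) = 2 ^ 2 by norm_num, Real.log_pow]; norm_num
  rw [h]
  have := Real.log_two_gt_d9
  linarith

/-- The key telescoping inequality: for real `n ≥ 4`,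
`log n/n² ≤ (log(n−1) + 1)/(n−1) − (log n + 1)/n`. [folklore] -/
theorem log_div_sq_le_sub {n : ℝ} (hn : 4 ≤ n) :
    Real.log n / n ^ 2 ≤ (Real.log (n - 1) + 1) / (n - 1) - (Real.log n + 1) / n := by
  have h1 : 0 < n - 1 := by linarith
  have h0 : 0 < n := by linarith
  -- `log(n-1) ≥ log n − 1/(n−1)`
  have hlog : Real.log n - 1 / (n - 1) ≤ Real.log (n - 1) := by
    have h := Real.log_le_sub_one_of_pos (x := n / (n - 1)) (by positivity)
    rw [Real.log_div h0.ne' h1.ne'] at h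
    have e : n / (n - 1) - 1 = 1 / (n - 1) := by field_simp; ring
    linarith
  -- `(n − 1) log n ≥ n`
  have hlog4 : Real.log 4 ≤ Real.log n := Real.log_le_log (by norm_num) hn
  have hkey : n ≤ (n - 1) * Real.log n := by nlinarith [log_four_gt]
  have hlogn : 0 ≤ Real.log n := by linarith [log_four_gt]
  -- compare with the lower bound obtained from `hlog`
  have step : (Real.log n - 1 / (n - 1) + 1) / (n - 1) - (Real.log n + 1) / n ≤
      (Real.log (n - 1) + 1) / (n - 1) - (Real.log n + 1) / n := by
    gcongr
  refine le_trans ?_ step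
  have e : (Real.log n - 1 / (n - 1) + 1) / (n - 1) - (Real.log n + 1) / n - Real.log n / n ^ 2 =
      ((n - 1) * Real.log n - n) / (n ^ 2 * (n - 1) ^ 2) := by
    field_simp
    ring
  have : 0 ≤ ((n - 1) * Real.log n - n) / (n ^ 2 * (n - 1) ^ 2) := div_nonneg (by linarith) (by positivity)
  linarith

/-- `∑_{j<J} log(t₀+j)/(t₀+j)² ≤ log t₀/t₀² + g(t₀) − g(t₀+J−1)`, `g(x) = (log x + 1)/x`, for
`J ≥ 1`, `t₀ ≥ 4`. [folklore] -/
theorem sum_log_div_sq_le_aux {t₀ : ℝ} (ht₀ : 4 ≤ t₀) (J : ℕ) (hJ : 1 ≤ J) :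
    ∑ j ∈ range J, Real.log (t₀ + j) / (t₀ + j) ^ 2 ≤
      Real.log t₀ / t₀ ^ 2 + (Real.log t₀ + 1) / t₀ - (Real.log (t₀ + J - 1) + 1) / (t₀ + J - 1) := by
  induction J, hJ using Nat.le_induction with
  | base => simp
  | succ n hn ih =>
    rw [sum_range_succ]
    have hn' : (1 : ℝ) ≤ n := by exact_mod_cast hn
    have key := log_div_sq_le_sub (n := t₀ + n) (by linarith)
    push_cast
    have e : (t₀ + (n + 1) - 1 : ℝ) = t₀ + n := by ring
    rw [e]
    linarith

/-- **`∑_{j<J} log(t₀+j)/(t₀+j)² ≤ log t₀/t₀² + (log t₀ + 1)/t₀`** (`t₀ ≥ 4`). [folklore] -/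
theorem sum_log_div_sq_le {t₀ : ℝ} (ht₀ : 4 ≤ t₀) (J : ℕ) :
    ∑ j ∈ range J, Real.log (t₀ + j) / (t₀ + j) ^ 2 ≤ Real.log t₀ / t₀ ^ 2 + (Real.log t₀ + 1) / t₀ := by
  rcases Nat.eq_zero_or_pos J with h | h
  · subst h
    simp
    have : 0 ≤ Real.log t₀ := Real.log_nonneg (by linarith)
    positivity
  · have := sum_log_div_sq_le_aux ht₀ J h
    have hJ : (1 : ℝ) ≤ J := by exact_mod_cast h
    have h4 : 4 ≤ t₀ + J - 1 := by linarith
    have : 0 ≤ (Real.log (t₀ + J - 1) + 1) / (t₀ + J - 1) :=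
      div_nonneg (by linarith [Real.log_nonneg (by linarith : (1 : ℝ) ≤ t₀ + J - 1)]) (by linarith)
    linarith

/-! ## The unit-window zero count -/

/-- `log(7/6) ≥ 1/7` and `log 120 ≤ 5`. [folklore] -/
theorem log_consts : 1 / 7 ≤ Real.log (7 / 6) ∧ Real.log 120 ≤ 5 := by
  constructor
  · have h := Real.add_one_le_exp (Real.log (7 / 6))
    have h' := Real.one_sub_inv_le_log_of_pos (x := (7 / 6 : ℝ)) (by norm_num)
    norm_num at h'
    linarith
  · have h : (120 : ℝ) ≤ Real.exp 5 := by
      have := Real.exp_one_gt_d9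
      have h5 : Real.exp 5 = Real.exp 1 ^ 5 := by rw [← Real.exp_nat_mul]; norm_num
      rw [h5]
      nlinarith [pow_le_pow_left₀ (by norm_num : (0:ℝ) ≤ 2.7182818283) this.le 5]
    calc Real.log 120 ≤ Real.log (Real.exp 5) := Real.log_le_log (by norm_num) h
      _ = 5 := Real.log_exp 5

/-- `argBound u ≤ 38 + 7.2 log(u + 6)` hence `2 argBound(u+1)`-type sums are `≤ 76 + 14.4 log(u+6)`:
precisely, for `u ≥ 0`, `argBound (u + 1) ≤ 38 + 7.2 * log (u + 6)`. [folklore] -/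
theorem argBound_le {u : ℝ} (hu : 0 ≤ u) : argBound (u + 1) ≤ 38 + 7.2 * Real.log (u + 6) := by
  obtain ⟨h76, h120⟩ := log_consts
  unfold argBound
  have hl6 : 0 ≤ Real.log (u + 6) := Real.log_nonneg (by linarith)
  have h1 : Real.log (120 * (u + 1 + 5)) = Real.log 120 + Real.log (u + 6) := by
    rw [show u + 1 + 5 = u + 6 by ring, Real.log_mul (by norm_num) (by linarith)]
  have h2 : Real.log (120 * (u + 1 + 5)) / Real.log (7 / 6) ≤ 7 * (5 + Real.log (u + 6)) := by
    rw [h1, div_le_iff₀ (by linarith)]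
    nlinarith
  have h3 : Real.log (u + 1 + 1) ≤ Real.log (u + 6) := Real.log_le_log (by linarith) (by linarith)
  have h4 : 0 ≤ Real.log (u + 1 + 1) := Real.log_nonneg (by linarith)
  linarith

/-- `countMain (u+1) − countMain u ≤ log(u+1)/(2π)` for `u ≥ 7`: the main term grows at rate
`log(t/2π)/(2π)`. [cite: Titchmarsh1986, Thm. 9.4] -/
theorem countMain_sub_le {u : ℝ} (hu : 7 ≤ u) :
    countMain (u + 1) - countMain u ≤ Real.log (u + 1) / (2 * π) := by
  unfold countMain
  have hπ := Real.pi_pos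
  have hπ3 := Real.pi_gt_three
  have hu0 : 0 < u := by linarith
  -- `u log((u+1)/u) ≤ 1`
  have h1 : u * (Real.log ((u + 1) / (2 * π)) - Real.log (u / (2 * π))) ≤ 1 := by
    rw [← Real.log_div (by positivity) (by positivity)]
    have e : (u + 1) / (2 * π) / (u / (2 * π)) = 1 + 1 / u := by field_simp
    rw [e]
    have := Real.log_le_sub_one_of_pos (x := 1 + 1 / u) (by positivity)
    have e2 : u * (1 + 1 / u - 1) = 1 := by field_simp; ring
    nlinarith
  have h2 : Real.log ((u + 1) / (2 * π)) ≤ Real.log (u + 1) := by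
    apply Real.log_le_log (by positivity)
    rw [div_le_iff₀ (by positivity)]
    nlinarith
  have key : (u + 1) / (2 * π) * Real.log ((u + 1) / (2 * π)) - (u + 1) / (2 * π) + 7 / 8 -
      (u / (2 * π) * Real.log (u / (2 * π)) - u / (2 * π) + 7 / 8) =
      (u * (Real.log ((u + 1) / (2 * π)) - Real.log (u / (2 * π))) + Real.log ((u + 1) / (2 * π)) - 1) / (2 * π) := by
    field_simp
    ring
  rw [key, div_le_div_iff_of_pos_right (by positivity)]
  linarith

/-- **The unit-window count**: for `u ≥ 7`, `N(u+1) − N(u) ≤ 77 + 15 log(u + 6)` (zeros with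
`u < γ ≤ u+1`, with multiplicity; crude constants from the tree's explicit `N⁺`, `N⁻`).
[cite: Titchmarsh1986, Thm. 9.4] -/
theorem window_le_of_ge_seven {u : ℝ} (hu : 7 ≤ u) :
    (zetaZeroCount (u + 1) : ℝ) - zetaZeroCount u ≤ 77 + 15 * Real.log (u + 6) := by
  have hup := zetaZeroCount_le_countUpper (t := u + 1) (by linarith)
  have hlo := countLower_le_zetaZeroCount hu
  have hK := stirlingVertRate_quarter_lt
  have hK0 : 0 ≤ stirlingVertRate (1 / 4) := by unfold stirlingVertRate; positivity
  have hπ := Real.pi_pos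
  have hπ3 := Real.pi_gt_three
  have hmain := countMain_sub_le hu
  have harg1 := argBound_le (u := u) (by linarith)
  have harg0 : argBound u ≤ 38 + 7.2 * Real.log (u + 6) := by
    have := argBound_le (u := u - 1) (by linarith)
    rw [show u - 1 + 1 = u by ring, show u - 1 + 6 = u + 5 by ring] at this
    have : Real.log (u + 5) ≤ Real.log (u + 6) := Real.log_le_log (by linarith) (by linarith)
    linarith
  have hs1 : 2 * stirlingVertRate (1 / 4) / (π * (u + 1)) ≤ 0.06 := by
    rw [div_le_iff₀ (by positivity)]; nlinarith
  have hs0 : 2 * stirlingVertRate (1 / 4) / (π * u) ≤ 0.06 := by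
    rw [div_le_iff₀ (by positivity)]; nlinarith
  have hl1 : Real.log (u + 1) / (2 * π) ≤ Real.log (u + 6) / 6 := by
    rw [div_le_div_iff₀ (by positivity) (by norm_num)]
    have := Real.log_le_log (by linarith : 0 < u + 1) (by linarith : u + 1 ≤ u + 6)
    have h0 : 0 ≤ Real.log (u + 1) := Real.log_nonneg (by linarith)
    nlinarith
  have hl6 : 0 ≤ Real.log (u + 6) := Real.log_nonneg (by linarith)
  unfold countUpper at hup
  unfold countLower at hlo
  linarith

/-- `N(8) ≤ 62`. [cite: Titchmarsh1986, Thm. 9.4] -/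
theorem zetaZeroCount_eight_le : (zetaZeroCount 8 : ℝ) ≤ 62 := by
  have hup := zetaZeroCount_le_countUpper (t := 8) (by norm_num)
  have hK := stirlingVertRate_quarter_lt
  have hπ := Real.pi_pos
  have hπ3 := Real.pi_gt_three
  have harg := argBound_le (u := 7) (by norm_num)
  norm_num at harg
  obtain ⟨-, h120⟩ := log_consts
  have hl13 : Real.log 13 ≤ 3 := by
    have h : (13 : ℝ) ≤ Real.exp 3 := by
      have := Real.exp_one_gt_d9
      have h3 : Real.exp 3 = Real.exp 1 ^ 3 := by rw [← Real.exp_nat_mul]; norm_num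
      rw [h3]; nlinarith [pow_le_pow_left₀ (by norm_num : (0:ℝ) ≤ 2.7182818283) this.le 3]
    calc Real.log 13 ≤ Real.log (Real.exp 3) := Real.log_le_log (by norm_num) h
      _ = 3 := Real.log_exp 3
  have hmain : countMain 8 ≤ 1 := by
    unfold countMain
    have h1 : Real.log (8 / (2 * π)) ≤ 1 := by
      have : 8 / (2 * π) ≤ Real.exp 1 := by
        rw [div_le_iff₀ (by positivity)]
        have := Real.exp_one_gt_d9
        nlinarith
      calc Real.log (8 / (2 * π)) ≤ Real.log (Real.exp 1) := Real.log_le_log (by positivity) this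
        _ = 1 := Real.log_exp 1
    have h2 : 0 < 8 / (2 * π) := by positivity
    have h3 : 8 / (2 * π) ≤ 2 := by rw [div_le_iff₀ (by positivity)]; nlinarith
    nlinarith
  have hs : 2 * stirlingVertRate (1 / 4) / (π * 8) ≤ 0.06 := by
    rw [div_le_iff₀ (by positivity)]; nlinarith
  unfold countUpper at hup
  linarith

/-- **The unit-window count for all `u ≥ 0`**: `N(u+1) − N(u) ≤ 77 + 15 log(u+6)`.
[cite: Titchmarsh1986, Thm. 9.4] -/
theorem window_le {u : ℝ} (hu : 0 ≤ u) :
    (zetaZeroCount (u + 1) : ℝ) - zetaZeroCount u ≤ 77 + 15 * Real.log (u + 6) := by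
  rcases le_or_gt 7 u with h | h
  · exact window_le_of_ge_seven h
  · have hmono : (zetaZeroCount (u + 1) : ℝ) ≤ zetaZeroCount 8 := by
      exact_mod_cast zetaZeroCount_mono (by linarith : u + 1 ≤ 8)
    have h0 : (0 : ℝ) ≤ zetaZeroCount u := by positivity
    have hl6 : 0 ≤ Real.log (u + 6) := Real.log_nonneg (by linarith)
    linarith [zetaZeroCount_eight_le]

/-! ## The tail bound function -/

/-- The crude explicit tail bound
`B(C, t₀) = (154 + 30 log(C+7))(1/t₀² + 1/t₀) + 30(log t₀/t₀² + (log t₀ + 1)/t₀)`, of the shape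
`O((log(C + 7) + log t₀)/t₀)`. [folklore] -/
def tailBound (C t₀ : ℝ) : ℝ :=
  (154 + 30 * Real.log (C + 7)) * (1 / t₀ ^ 2 + 1 / t₀) +
    30 * (Real.log t₀ / t₀ ^ 2 + (Real.log t₀ + 1) / t₀)

/-- `B(C, t₀) ≥ 0` for `C ≥ 0`, `t₀ ≥ 1`. [folklore] -/
theorem tailBound_nonneg {C t₀ : ℝ} (hC : 0 ≤ C) (ht₀ : 1 ≤ t₀) : 0 ≤ tailBound C t₀ := by
  unfold tailBound
  have h1 : 0 ≤ Real.log (C + 7) := Real.log_nonneg (by linarith)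
  have h2 : 0 ≤ Real.log t₀ := Real.log_nonneg ht₀
  positivity

/-- `B(C, t₀)` is monotone in `C`. [folklore] -/
theorem tailBound_mono {C C' t₀ : ℝ} (hC : 0 ≤ C) (hCC' : C ≤ C') (ht₀ : 1 ≤ t₀) :
    tailBound C t₀ ≤ tailBound C' t₀ := by
  unfold tailBound
  have h : Real.log (C + 7) ≤ Real.log (C' + 7) := Real.log_le_log (by linarith) (by linarith)
  have h0 : 0 ≤ 1 / t₀ ^ 2 + 1 / t₀ := by positivity
  nlinarith

/-- The per-window summation: `∑_{j<J} (154 + 30 log(C+7) + 30 log(t₀+j))/(t₀+j)² ≤ B(C, t₀)`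
(`C ≥ 0`, `t₀ ≥ 4`). [folklore] -/
theorem sum_window_bound_le {C t₀ : ℝ} (hC : 0 ≤ C) (ht₀ : 4 ≤ t₀) (J : ℕ) :
    ∑ j ∈ range J, (154 + 30 * Real.log (C + 7) + 30 * Real.log (t₀ + j)) / (t₀ + j) ^ 2 ≤
      tailBound C t₀ := by
  have h1 := sum_inv_sq_le (t₀ := t₀) (by linarith) J
  have h2 := sum_log_div_sq_le ht₀ J
  have hl : 0 ≤ Real.log (C + 7) := Real.log_nonneg (by linarith)
  have e : ∑ j ∈ range J, (154 + 30 * Real.log (C + 7) + 30 * Real.log (t₀ + j)) / (t₀ + j) ^ 2 =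
      (154 + 30 * Real.log (C + 7)) * ∑ j ∈ range J, 1 / (t₀ + j) ^ 2 +
        30 * ∑ j ∈ range J, Real.log (t₀ + j) / (t₀ + j) ^ 2 := by
    rw [mul_sum, mul_sum, ← sum_add_distrib]
    refine sum_congr rfl fun j _ ↦ ?_
    have : (0 : ℝ) < t₀ + j := by positivity
    field_simp
  rw [e]
  unfold tailBound
  have h77 : 0 ≤ 154 + 30 * Real.log (C + 7) := by positivity
  nlinarith [mul_le_mul_of_nonneg_left h1 h77]

/-! ## The count in one window, at any real position -/

/-- Zeros of `ζ` with `0 ≤ Re ρ ≤ 1`, `0 < Im ρ` and `u ≤ Im ρ ≤ u + 1` (any real `u`) have total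
multiplicity `≤ 154 + 30 log(|u| + 7)` (two unit windows `(u', u'+1]`, `(u'+1, u'+2]`,
`u' = max(u − 1, 0)`). [cite: Titchmarsh1986, Thm. 9.4] -/
theorem sum_le_window {u : ℝ} (s : Finset ℂ)
    (hs : ∀ ρ ∈ s, riemannZeta ρ = 0 ∧ 0 ≤ ρ.re ∧ ρ.re ≤ 1 ∧ 0 < ρ.im ∧ u ≤ ρ.im ∧ ρ.im ≤ u + 1) :
    ∑ ρ ∈ s, (riemannZetaZeroOrder ρ : ℝ) ≤ 154 + 30 * Real.log (|u| + 7) := by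
  classical
  set u' : ℝ := max (u - 1) 0 with hu'
  have hu'0 : 0 ≤ u' := le_max_right _ _
  have hsub : s ⊆ zerosBetween u' (u' + 2) := by
    intro ρ hρ
    obtain ⟨hz, h1, h2, h3, h4, h5⟩ := hs ρ hρ
    rw [mem_zerosBetween hu'0]
    refine ⟨hz, h1, h2, max_lt (by linarith) h3, ?_⟩
    have := le_max_left (u - 1) 0
    linarith
  have h1 : ∑ ρ ∈ s, (riemannZetaZeroOrder ρ : ℝ) ≤ ∑ ρ ∈ zerosBetween u' (u' + 2), (riemannZetaZeroOrder ρ : ℝ) :=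
    sum_le_sum_of_subset_of_nonneg hsub fun ρ hρ _ ↦ zeroOrder_nonneg_of_mem_zerosBetween hu'0 hρ
  rw [← zetaZeroCount_sub_eq_sum (by linarith)] at h1
  have h2 := window_le hu'0
  have h2' := window_le (u := u' + 1) (by linarith)
  rw [show u' + 1 + 1 = u' + 2 by ring] at h2'
  have hle : u' ≤ |u| := max_le (by linarith [le_abs_self u]) (abs_nonneg u)
  have h3 : Real.log (u' + 6) ≤ Real.log (|u| + 7) := Real.log_le_log (by linarith) (by linarith)
  have h3' : Real.log (u' + 1 + 6) ≤ Real.log (|u| + 7) := Real.log_le_log (by linarith) (by linarith)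
  linarith

/-! ## Upper and lower one-sided tails over finite sets of zeros -/

/-- `log(|u| + 7) ≤ log(C + 7) + log(t₀ + j)` when `|u| ≤ C + t₀ + j + 1`, `C ≥ 0`, `t₀ ≥ 2`.
[folklore] -/
theorem log_window_le {u C t₀ : ℝ} {j : ℕ} (hC : 0 ≤ C) (ht₀ : 2 ≤ t₀) (hu : |u| ≤ C + t₀ + j + 1) :
    Real.log (|u| + 7) ≤ Real.log (C + 7) + Real.log (t₀ + j) := by
  have hj : (0 : ℝ) ≤ j := Nat.cast_nonneg j
  rw [← Real.log_mul (by linarith) (by linarith)]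
  apply Real.log_le_log (by positivity)
  nlinarith

/-- **Upper one-sided tail**: for a finite set `s` of zeros of `ζ` in the upper critical strip with
`Im ρ ≥ c + t₀` (`t₀ ≥ 4`), `∑_{ρ ∈ s} m(ρ)/(Im ρ − c)² ≤ B(|c|, t₀)`. [cite: Kadiri2005, Lemma 4.3] -/
theorem upper_sum_le {c t₀ : ℝ} (ht₀ : 4 ≤ t₀) (s : Finset ℂ)
    (hs : ∀ ρ ∈ s, riemannZeta ρ = 0 ∧ 0 ≤ ρ.re ∧ ρ.re ≤ 1 ∧ 0 < ρ.im ∧ c + t₀ ≤ ρ.im) :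
    ∑ ρ ∈ s, (riemannZetaZeroOrder ρ : ℝ) / (ρ.im - c) ^ 2 ≤ tailBound |c| t₀ := by
  classical
  -- window index
  set w : ℂ → ℕ := fun ρ ↦ ⌊ρ.im - c - t₀⌋₊ with hw
  set J : ℕ := s.sup w + 1 with hJ
  have hmaps : ∀ ρ ∈ s, w ρ ∈ range J := fun ρ hρ ↦
    mem_range.2 (Nat.lt_succ_of_le (le_sup hρ))
  rw [← sum_fiberwise_of_maps_to hmaps]
  refine le_trans (sum_le_sum fun j hj ↦ ?_) (sum_window_bound_le (abs_nonneg c) ht₀ J)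
  -- the fiber `w ρ = j`: `t₀ + j ≤ Im ρ − c < t₀ + j + 1`
  have hfib : ∀ ρ ∈ s.filter (fun ρ ↦ w ρ = j), t₀ + j ≤ ρ.im - c ∧ ρ.im - c < t₀ + j + 1 := by
    intro ρ hρ
    rw [mem_filter] at hρ
    obtain ⟨hρs, hρj⟩ := hρ
    have h0 : 0 ≤ ρ.im - c - t₀ := by linarith [(hs ρ hρs).2.2.2.2]
    have h1 := Nat.floor_le h0
    have h2 := Nat.lt_floor_add_one (ρ.im - c - t₀)
    have hwj : ((⌊ρ.im - c - t₀⌋₊ : ℕ) : ℝ) = j := by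
      have : w ρ = j := hρj
      simp only [hw] at this
      exact_mod_cast this
    rw [hwj] at h1 h2
    constructor <;> linarith
  have htj : (0 : ℝ) < t₀ + j := by positivity
  -- bound each term by `m(ρ)/(t₀+j)²`, then the window count
  calc ∑ ρ ∈ s.filter (fun ρ ↦ w ρ = j), (riemannZetaZeroOrder ρ : ℝ) / (ρ.im - c) ^ 2
      ≤ ∑ ρ ∈ s.filter (fun ρ ↦ w ρ = j), (riemannZetaZeroOrder ρ : ℝ) / (t₀ + j) ^ 2 := by
        refine sum_le_sum fun ρ hρ ↦ ?_
        obtain ⟨h1, -⟩ := hfib ρ hρ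
        have hm : (0 : ℝ) ≤ riemannZetaZeroOrder ρ := by
          have hρs := (mem_filter.1 hρ).1
          obtain ⟨hz, -, -, him, -⟩ := hs ρ hρs
          exact_mod_cast zero_le_one.trans (ZetaZeros.riemannZetaNontrivialZeros.one_le_order
            (ZetaZeros.riemannZetaNontrivialZeros.mem_of_im_ne_zero hz him.ne'))
        exact div_le_div_of_nonneg_left hm (by positivity) (pow_le_pow_left₀ htj.le h1 2)
    _ = (∑ ρ ∈ s.filter (fun ρ ↦ w ρ = j), (riemannZetaZeroOrder ρ : ℝ)) / (t₀ + j) ^ 2 := by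
        rw [sum_div]
    _ ≤ (154 + 30 * Real.log (|c + t₀ + j| + 7)) / (t₀ + j) ^ 2 := by
        refine div_le_div_of_nonneg_right (sum_le_window _ fun ρ hρ ↦ ?_) (by positivity)
        obtain ⟨h1, h2⟩ := hfib ρ hρ
        obtain ⟨hz, hre0, hre1, him, -⟩ := hs ρ (mem_filter.1 hρ).1
        exact ⟨hz, hre0, hre1, him, by linarith, by linarith⟩
    _ ≤ (154 + 30 * Real.log (|c| + 7) + 30 * Real.log (t₀ + j)) / (t₀ + j) ^ 2 := by
        refine div_le_div_of_nonneg_right ?_ (by positivity)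
        have hu : |c + t₀ + j| ≤ |c| + t₀ + j + 1 := by
          have := abs_add_le c (t₀ + j)
          rw [abs_of_pos htj] at this
          rw [show c + t₀ + j = c + (t₀ + j) by ring]
          linarith
        have := log_window_le (abs_nonneg c) (by linarith) hu
        linarith

/-- **Lower one-sided tail**: for a finite set `s` of zeros of `ζ` in the upper critical strip with
`0 < Im ρ ≤ c − t₀` (`t₀ ≥ 4`), `∑_{ρ ∈ s} m(ρ)/(Im ρ − c)² ≤ B(|c|, t₀)`. [cite: Kadiri2005, Lemma 4.3] -/
theorem lower_sum_le {c t₀ : ℝ} (ht₀ : 4 ≤ t₀) (s : Finset ℂ)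
    (hs : ∀ ρ ∈ s, riemannZeta ρ = 0 ∧ 0 ≤ ρ.re ∧ ρ.re ≤ 1 ∧ 0 < ρ.im ∧ ρ.im ≤ c - t₀) :
    ∑ ρ ∈ s, (riemannZetaZeroOrder ρ : ℝ) / (ρ.im - c) ^ 2 ≤ tailBound |c| t₀ := by
  classical
  set w : ℂ → ℕ := fun ρ ↦ ⌊c - t₀ - ρ.im⌋₊ with hw
  set J : ℕ := s.sup w + 1 with hJ
  have hmaps : ∀ ρ ∈ s, w ρ ∈ range J := fun ρ hρ ↦
    mem_range.2 (Nat.lt_succ_of_le (le_sup hρ))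
  rw [← sum_fiberwise_of_maps_to hmaps]
  refine le_trans (sum_le_sum fun j hj ↦ ?_) (sum_window_bound_le (abs_nonneg c) ht₀ J)
  have hfib : ∀ ρ ∈ s.filter (fun ρ ↦ w ρ = j), t₀ + j ≤ c - ρ.im ∧ c - ρ.im < t₀ + j + 1 := by
    intro ρ hρ
    rw [mem_filter] at hρ
    obtain ⟨hρs, hρj⟩ := hρ
    have h0 : 0 ≤ c - t₀ - ρ.im := by linarith [(hs ρ hρs).2.2.2.2]
    have h1 := Nat.floor_le h0
    have h2 := Nat.lt_floor_add_one (c - t₀ - ρ.im)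
    have hwj : ((⌊c - t₀ - ρ.im⌋₊ : ℕ) : ℝ) = j := by
      have : w ρ = j := hρj
      simp only [hw] at this
      exact_mod_cast this
    rw [hwj] at h1 h2
    constructor <;> linarith
  have htj : (0 : ℝ) < t₀ + j := by positivity
  calc ∑ ρ ∈ s.filter (fun ρ ↦ w ρ = j), (riemannZetaZeroOrder ρ : ℝ) / (ρ.im - c) ^ 2
      ≤ ∑ ρ ∈ s.filter (fun ρ ↦ w ρ = j), (riemannZetaZeroOrder ρ : ℝ) / (t₀ + j) ^ 2 := by
        refine sum_le_sum fun ρ hρ ↦ ?_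
        obtain ⟨h1, -⟩ := hfib ρ hρ
        have hm : (0 : ℝ) ≤ riemannZetaZeroOrder ρ := by
          have hρs := (mem_filter.1 hρ).1
          obtain ⟨hz, -, -, him, -⟩ := hs ρ hρs
          exact_mod_cast zero_le_one.trans (ZetaZeros.riemannZetaNontrivialZeros.one_le_order
            (ZetaZeros.riemannZetaNontrivialZeros.mem_of_im_ne_zero hz him.ne'))
        refine div_le_div_of_nonneg_left hm (by positivity) ?_
        rw [show (ρ.im - c) ^ 2 = (c - ρ.im) ^ 2 by ring]
        exact pow_le_pow_left₀ htj.le h1 2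
    _ = (∑ ρ ∈ s.filter (fun ρ ↦ w ρ = j), (riemannZetaZeroOrder ρ : ℝ)) / (t₀ + j) ^ 2 := by
        rw [sum_div]
    _ ≤ (154 + 30 * Real.log (|c - t₀ - j - 1| + 7)) / (t₀ + j) ^ 2 := by
        refine div_le_div_of_nonneg_right (sum_le_window _ fun ρ hρ ↦ ?_) (by positivity)
        obtain ⟨h1, h2⟩ := hfib ρ hρ
        obtain ⟨hz, hre0, hre1, him, -⟩ := hs ρ (mem_filter.1 hρ).1
        exact ⟨hz, hre0, hre1, him, by linarith, by linarith⟩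
    _ ≤ (154 + 30 * Real.log (|c| + 7) + 30 * Real.log (t₀ + j)) / (t₀ + j) ^ 2 := by
        refine div_le_div_of_nonneg_right ?_ (by positivity)
        have hu : |c - t₀ - j - 1| ≤ |c| + t₀ + j + 1 := by
          rw [show c - t₀ - j - 1 = c - (t₀ + j + 1) by ring]
          have := abs_sub c (t₀ + j + 1)
          rw [abs_of_pos (by positivity : (0 : ℝ) < t₀ + j + 1)] at this
          linarith
        have := log_window_le (abs_nonneg c) (by linarith) hu
        linarith

/-! ## The two-sided tail over the non-trivial zeros -/

/-- **The far-zero tail, finite form.** For `t ≥ 0`, `t₀ ≥ 4` and every finite set `s` of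
non-trivial zeros of `ζ`,
`∑_{ρ ∈ s, |Im ρ − t| ≥ t₀} m(ρ)/(Im ρ − t)² ≤ 3 B(t, t₀)`,
`B = tailBound` (the three pieces: `Im ρ ≥ t + t₀`; `0 < Im ρ ≤ t − t₀`; `Im ρ < 0`, reflected by
conjugation to `Im ρ̄ ≥ −t + t₀`, `m(ρ̄) = m(ρ)`). Hence the same bound for the infinite sum.
[cite: Kadiri2005, Lemma 4.3] -/
theorem sum_far_le {t t₀ : ℝ} (ht : 0 ≤ t) (ht₀ : 4 ≤ t₀) (s : Finset Zeros) :
    ∑ ρ ∈ s, (if t₀ ≤ |(ρ : ℂ).im - t| then (riemannZetaZeroOrder (ρ : ℂ) : ℝ) / ((ρ : ℂ).im - t) ^ 2 else 0)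
      ≤ 3 * tailBound t t₀ := by
  classical
  -- split `s` into the three relevant pieces (and the irrelevant near zeros)
  set s₁ : Finset Zeros := s.filter (fun ρ : Zeros ↦ t + t₀ ≤ (ρ : ℂ).im) with hs₁
  set s₂ : Finset Zeros := s.filter (fun ρ : Zeros ↦ 0 < (ρ : ℂ).im ∧ (ρ : ℂ).im ≤ t - t₀) with hs₂
  set s₃ : Finset Zeros := s.filter (fun ρ : Zeros ↦ (ρ : ℂ).im < 0 ∧ t₀ ≤ t - (ρ : ℂ).im) with hs₃
  have hmem : ∀ ρ : Zeros, (ρ : ℂ) ∈ RHWave0.riemannZetaNontrivialZeros := fun ρ ↦ ρ.2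
  -- pointwise: the summand equals the sum of the three filtered summands
  have hpt : ∀ ρ ∈ s,
      (if t₀ ≤ |(ρ : ℂ).im - t| then (riemannZetaZeroOrder (ρ : ℂ) : ℝ) / ((ρ : ℂ).im - t) ^ 2 else 0) =
        (if t + t₀ ≤ (ρ : ℂ).im then (riemannZetaZeroOrder (ρ : ℂ) : ℝ) / ((ρ : ℂ).im - t) ^ 2 else 0) +
        (if 0 < (ρ : ℂ).im ∧ (ρ : ℂ).im ≤ t - t₀ then (riemannZetaZeroOrder (ρ : ℂ) : ℝ) / ((ρ : ℂ).im - t) ^ 2 else 0) +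
        (if (ρ : ℂ).im < 0 ∧ t₀ ≤ t - (ρ : ℂ).im then (riemannZetaZeroOrder (ρ : ℂ) : ℝ) / ((ρ : ℂ).im - t) ^ 2 else 0) := by
    intro ρ _
    have him : (ρ : ℂ).im ≠ 0 := ZetaZeros.riemannZetaNontrivialZeros.im_ne_zero (hmem ρ)
    by_cases h : t₀ ≤ |(ρ : ℂ).im - t|
    · rw [if_pos h]
      rcases le_or_gt 0 ((ρ : ℂ).im - t) with h0 | h0
      · rw [abs_of_nonneg h0] at h
        rw [if_pos (by linarith), if_neg (by intro h'; linarith [h'.2]), if_neg (by intro h'; linarith [h'.1])]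
        ring
      · rw [abs_of_neg h0] at h
        rw [if_neg (by linarith)]
        rcases lt_or_gt_of_ne him with h1 | h1
        · rw [if_neg (by intro h'; linarith [h'.1]), if_pos ⟨h1, by linarith⟩]; ring
        · rw [if_pos ⟨h1, by linarith⟩, if_neg (by intro h'; linarith [h'.1])]; ring
    · rw [if_neg h]
      push Not at h
      have h' := abs_lt.1 h
      rw [if_neg (by linarith [h'.2]), if_neg (by intro h''; linarith [h''.2, h'.1]),
        if_neg (by intro h''; linarith [h''.2, h'.1])]
      ring
  rw [sum_congr rfl hpt, sum_add_distrib, sum_add_distrib, ← sum_filter, ← sum_filter, ← sum_filter]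
  -- piece 1: upper tail at centre `t`
  have hinj : ∀ (u : Finset Zeros), Set.InjOn (fun ρ : Zeros ↦ (ρ : ℂ)) u :=
    fun u ρ _ ρ' _ h ↦ Subtype.ext h
  have h1 : ∑ ρ ∈ s₁, (riemannZetaZeroOrder (ρ : ℂ) : ℝ) / ((ρ : ℂ).im - t) ^ 2 ≤ tailBound |t| t₀ := by
    rw [← sum_image (f := fun z : ℂ ↦ (riemannZetaZeroOrder z : ℝ) / (z.im - t) ^ 2) (hinj s₁)]
    refine upper_sum_le ht₀ _ fun z hz ↦ ?_
    obtain ⟨ρ, hρ, rfl⟩ := mem_image.1 hz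
    have hρ' := (mem_filter.1 hρ).2
    have hm := hmem ρ
    exact ⟨ZetaZeros.riemannZetaNontrivialZeros.zeta_eq_zero hm,
      (ZetaZeros.riemannZetaNontrivialZeros.re_pos hm).le,
      (ZetaZeros.riemannZetaNontrivialZeros.re_lt_one hm).le, by linarith, hρ'⟩
  -- piece 2: lower tail at centre `t`
  have h2 : ∑ ρ ∈ s₂, (riemannZetaZeroOrder (ρ : ℂ) : ℝ) / ((ρ : ℂ).im - t) ^ 2 ≤ tailBound |t| t₀ := by
    rw [← sum_image (f := fun z : ℂ ↦ (riemannZetaZeroOrder z : ℝ) / (z.im - t) ^ 2) (hinj s₂)]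
    refine lower_sum_le ht₀ _ fun z hz ↦ ?_
    obtain ⟨ρ, hρ, rfl⟩ := mem_image.1 hz
    have hρ' := (mem_filter.1 hρ).2
    have hm := hmem ρ
    exact ⟨ZetaZeros.riemannZetaNontrivialZeros.zeta_eq_zero hm,
      (ZetaZeros.riemannZetaNontrivialZeros.re_pos hm).le,
      (ZetaZeros.riemannZetaNontrivialZeros.re_lt_one hm).le, hρ'.1, hρ'.2⟩
  -- piece 3: negative ordinates, by conjugation an upper tail at centre `−t`
  have hinj3 : Set.InjOn (fun ρ : Zeros ↦ conj (ρ : ℂ)) s₃ :=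
    fun ρ _ ρ' _ h ↦ Subtype.ext ((starRingEnd ℂ).injective h)
  have h3 : ∑ ρ ∈ s₃, (riemannZetaZeroOrder (ρ : ℂ) : ℝ) / ((ρ : ℂ).im - t) ^ 2 ≤ tailBound |-t| t₀ := by
    have e : ∀ ρ ∈ s₃, (riemannZetaZeroOrder (ρ : ℂ) : ℝ) / ((ρ : ℂ).im - t) ^ 2 =
        (fun z : ℂ ↦ (riemannZetaZeroOrder z : ℝ) / (z.im - (-t)) ^ 2) (conj (ρ : ℂ)) := by
      intro ρ _
      simp only [Complex.conj_im]
      rw [riemannZetaZeroOrder_conj_holds]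
      ring
    rw [sum_congr rfl e, ← sum_image (f := fun z : ℂ ↦ (riemannZetaZeroOrder z : ℝ) / (z.im - (-t)) ^ 2) hinj3]
    refine upper_sum_le ht₀ _ fun z hz ↦ ?_
    obtain ⟨ρ, hρ, rfl⟩ := mem_image.1 hz
    have hρ' := (mem_filter.1 hρ).2
    have hm := ZetaZeros.riemannZetaNontrivialZeros.conj_mem (hmem ρ)
    refine ⟨ZetaZeros.riemannZetaNontrivialZeros.zeta_eq_zero hm,
      (ZetaZeros.riemannZetaNontrivialZeros.re_pos hm).le,
      (ZetaZeros.riemannZetaNontrivialZeros.re_lt_one hm).le, ?_, ?_⟩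
    · simp only [Complex.conj_im]; linarith [hρ'.1]
    · simp only [Complex.conj_im]; linarith [hρ'.2]
  rw [abs_of_nonneg ht] at h1 h2
  rw [abs_neg, abs_of_nonneg ht] at h3
  linarith

/-- **The far-zero tail, infinite form**: for `t ≥ 0`, `t₀ ≥ 4`, the far-zero series is summable
and `∑'_{ρ, |Im ρ − t| ≥ t₀} m(ρ)/(Im ρ − t)² ≤ 3 B(t, t₀)`. [cite: Kadiri2005, Lemma 4.3] -/
theorem summable_far_and_tsum_le {t t₀ : ℝ} (ht : 0 ≤ t) (ht₀ : 4 ≤ t₀) :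
    Summable (fun ρ : Zeros ↦
      (if t₀ ≤ |(ρ : ℂ).im - t| then (riemannZetaZeroOrder (ρ : ℂ) : ℝ) / ((ρ : ℂ).im - t) ^ 2 else 0)) ∧
    ∑' ρ : Zeros,
        (if t₀ ≤ |(ρ : ℂ).im - t| then (riemannZetaZeroOrder (ρ : ℂ) : ℝ) / ((ρ : ℂ).im - t) ^ 2 else 0)
      ≤ 3 * tailBound t t₀ := by
  have hnn : 0 ≤ fun ρ : Zeros ↦
      (if t₀ ≤ |(ρ : ℂ).im - t| then (riemannZetaZeroOrder (ρ : ℂ) : ℝ) / ((ρ : ℂ).im - t) ^ 2 else 0) := by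
    intro ρ
    simp only [Pi.zero_apply]
    split_ifs
    · have : (0 : ℝ) ≤ riemannZetaZeroOrder (ρ : ℂ) := by
        exact_mod_cast zero_le_one.trans (ZetaZeros.riemannZetaNontrivialZeros.one_le_order ρ.2)
      positivity
    · exact le_rfl
  exact ⟨summable_of_sum_le hnn fun s ↦ sum_far_le ht ht₀ s,
    Real.tsum_le_of_sum_le hnn fun s ↦ sum_far_le ht ht₀ s⟩

end KadiriTail

end Literature.NumberTheory.LFunctions
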